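import Summits.ValiantsHypothesis.ValiantsHypothesis.Theorems.SymmetroidPencilBasics
import Summits.ValiantsHypothesis.ValiantsHypothesis.Theorems.LacunarySymmetroidMatrixDescartesCensusEdgeThreeNine
import Summits.ValiantsHypothesis.ValiantsHypothesis.Theorems.LacunarySymmetroidMatrixDescartesStubCommutingTwoSided
import Summits.ValiantsHypothesis.ValiantsHypothesis.Theorems.LacunarySymmetroidMatrixDescartesKernelDefiniteJunction
import Summits.ValiantsHypothesis.ValiantsHypothesis.Theorems.LacunarySymmetroidMatrixDescartesJunctionCeilingSeamDefs

/-!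
# `MatrixDescartes` — the JUNCTION CEILING, Theorems-side port 2/3: `KernelDefiniteJunction m` and ADDITIVITY of nonsingular
# junctions for all `m` (by name), and the kernel REFUTATION of «+1 per singular junction» at `m = 2` (`¬ SeamPlusOne 2`)

HONEST FRAMING (port).  Theorems of the crux workfile `Cruxes/MatrixDescartes/Lines/junction_ceiling.lean` (val-idea-5 g2 deliverable
(B), sha16 ec3c5bea67a7dcd8, 0 sorries) ported VERBATIM over the vocabulary file `…JunctionCeilingSeamDefs` (porter val-port-4 g1, val-lit
desk g11 RULING #233 (b)): §2's compositions — `kernelDefiniteJunction_holds` (the line's stub, = kj1's tree theorem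
`kernelDefiniteJunction`, p604951, re-folded by `δ`), `nonsingularJunctionAdditive_of_kernelDefinite` and
`nonsingularJunctionAdditive_holds` (the line's `stub_nonsingularJunctionAdditive`, now unconditional: scale-separated recombination through
a NONSINGULAR letter with nonsingular far ends is eventually EXACTLY additive in the positive-root count — the kernel's junction floor of
`Census.Chain` is also the ceiling), `kernelDefiniteJunction_of_nonsilent` (§8 monotonicity); §3 (`posM_le_one_of_binomial`); §4 = the
corank-one witness `SeamTwo` (`P = diag(0,1) + [[0,1],[1,0]]·X³ + diag(1,0)·X⁴`, `Q = diag(1,0) + [[0,−1],[−1,0]]·X + diag(0,1)·X³`,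
`Λ = t²`, `t ≥ 4`: `det H_Λ` alternates at `½, 2, t, 2t, 2t²`, FOUR roots = 1 + 1 + 2) and **`not_seamPlusOne_two : ¬ SeamPlusOne 2`**
— «a junction through a singular letter adds at most ONE root over the additive count» is FALSE at `m = 2`.  Witness data are small
`def`s (review-queued with the file; D-0009).  Nothing here is a law or bears on `MatrixDescartes` (stmt-ValiantsHypothesis-18050),
`DoorA26`, Conjecture B or VP ≠ VNP.  [folklore] (continuity/sign bookkeeping, Descartes with multiplicity).
-/

-- `Summit.ValiantsHypothesis.ValiantsHypothesis.…` repeats a component by the D-0017 layout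
-- (single-conjunct summit), which the `dupNamespace` linter flags; the name is mandated.
set_option linter.dupNamespace false
set_option autoImplicit false

namespace Summit.ValiantsHypothesis.ValiantsHypothesis.Theorems.LacunarySymmetroidMatrixDescartes.JunctionCeiling

open Polynomial Finset Filter
open scoped BigOperators
open Summit.ValiantsHypothesis.ValiantsHypothesis.Theorems.SymmetroidDescartes (eval_det_pencil le_card_posRoots_of_alternating)

/-! ## 2′. The stub and the additive ceiling, BY NAME -/


/-- **`KernelDefiniteJunction m` HOLDS for every `m`** — the line's ONE stub `stub_kernelDefiniteJunction`, a THEOREM of the tree: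
`kernelDefiniteJunction` (val-width-18050-kj1 g0, p604951, this namespace, statement = `KernelDefiniteJunction m` with the vocabulary
unfolded; here re-folded by `δ`). [folklore] -/
theorem kernelDefiniteJunction_holds (m : ℕ) : KernelDefiniteJunction m :=
  kernelDefiniteJunction m

/-- Nonsingular junction letters have trivial kernel and full rank: the additive ceiling is the rank-`m` case of the stub (kernel-checked
reduction; no sorry of its own). -/
theorem nonsingularJunctionAdditive_of_kernelDefinite (m : ℕ) (h : KernelDefiniteJunction m) :
    NonsingularJunctionAdditive m := by
  intro K₁ K₂ d S e T hd he hS hT h0 hS0 hJ hTl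
  have hrank : (S (Fin.last K₁)).rank = m := by
    have hu : IsUnit (S (Fin.last K₁)) :=
      (Matrix.isUnit_iff_isUnit_det _).2 (isUnit_iff_ne_zero.2 hJ)
    simpa [Fintype.card_fin] using Matrix.rank_of_isUnit _ hu
  have hker : ∀ v : Fin m → ℝ, v ≠ 0 → (S (Fin.last K₁)).mulVec v = 0 →
      (∀ l : Fin (K₁ + 1), l < Fin.last K₁ → (∀ l', l' < Fin.last K₁ → l' ≤ l) → v ⬝ᵥ (S l).mulVec v ≠ 0) ∧
      (∀ l : Fin (K₂ + 1), 0 < l → (∀ l', 0 < l' → l ≤ l') → v ⬝ᵥ (T l).mulVec v ≠ 0) :=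
    fun v hv hJv => absurd (Matrix.eq_zero_of_mulVec_eq_zero hJ hJv) hv
  have hev := h K₁ K₂ d S e T hd he hS hT h0 hS0 hTl hker
  refine hev.mono fun Λ hΛ => ?_
  simpa [hrank] using hΛ

/-- **NONSINGULAR JUNCTIONS ARE ADDITIVE, all `m`** (the line's `stub_nonsingularJunctionAdditive`, unconditional): scale-separated
recombination of two lacunary symmetric pencils through a NONSINGULAR shared letter, with nonsingular far ends, has eventually (in the
scale `Λ`) at most `Z•(det P) + Z•(det Q)` distinct positive roots — the kernel's junction FLOOR is also the CEILING. [folklore] -/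
theorem nonsingularJunctionAdditive_holds (m : ℕ) : NonsingularJunctionAdditive m :=
  nonsingularJunctionAdditive_of_kernelDefinite m (kernelDefiniteJunction_holds m)


/-- Monotonicity (kernel-checked, no sorry): nonsingular far ends are non-silent vacuously, so the sharpened statement implies the
booked stub `KernelDefiniteJunction`. [folklore] -/
theorem kernelDefiniteJunction_of_nonsilent (m : ℕ) (h : KernelNonsilentJunction m) : KernelDefiniteJunction m := by
  intro K₁ K₂ d S e T hd he hS hT h0 hS0 hTl hker
  have hbot : ∀ v : Fin m → ℝ, v ≠ 0 → (S 0).mulVec v = 0 →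
      ∀ l : Fin (K₁ + 1), 0 < l → (∀ l', 0 < l' → l ≤ l') → v ⬝ᵥ (S l).mulVec v ≠ 0 :=
    fun v hv hSv => absurd (Matrix.eq_zero_of_mulVec_eq_zero hS0 hSv) hv
  have htop : ∀ v : Fin m → ℝ, v ≠ 0 → (T (Fin.last K₂)).mulVec v = 0 →
      ∀ l : Fin (K₂ + 1), l < Fin.last K₂ → (∀ l', l' < Fin.last K₂ → l' ≤ l) → v ⬝ᵥ (T l).mulVec v ≠ 0 :=
    fun v hv hTv => absurd (Matrix.eq_zero_of_mulVec_eq_zero hTl hTv) hv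
  exact h K₁ K₂ d S e T hd he hS hT h0 hbot htop hker

/-! ## 3. Tools: Descartes with multiplicity for binomials -/

/-- Descartes with multiplicity for a binomial `C x * X ^ k + C y * X ^ n ≠ 0`: at most ONE positive root counted with
multiplicity (tree `Census.countP_posRoots_lt_card_support`: fewer sign-counted positive roots than monomials). [folklore] -/
theorem posM_le_one_of_binomial {p : ℝ[X]} (k n : ℕ) (x y : ℝ) (hp : p = C x * X ^ k + C y * X ^ n) (hp0 : p ≠ 0) :
    posM p ≤ 1 := by
  have h1 : p.roots.countP (fun t => 0 < t) < p.support.card :=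
    Summit.ValiantsHypothesis.ValiantsHypothesis.Theorems.LacunarySymmetroidMatrixDescartes.Census.countP_posRoots_lt_card_support hp0
  have h2 : p.support.card ≤ 2 := by
    rw [hp]
    exact (Finset.card_le_card (support_binomial_subset k n x y)).trans (Finset.card_le_two)
  unfold posM
  omega

/-! ## 4. The kernel refutation of «+1»: a corank-one junction with seam excess TWO (m = 2) -/

namespace SeamTwo

/-- `P`'s exponents `(0, 3, 4)`. -/
def dP : Fin 3 → ℕ := ![0, 3, 4]
/-- `P`'s letters: bottom `diag(0,1)`, middle `[[0,1],[1,0]]`, top (junction) `J = diag(1,0)`. -/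
def SP : Fin 3 → Matrix (Fin 2) (Fin 2) ℝ := ![!![0, 0; 0, 1], !![0, 1; 1, 0], !![1, 0; 0, 0]]
/-- `Q`'s exponents `(0, 1, 3)`. -/
def eQ : Fin 3 → ℕ := ![0, 1, 3]
/-- `Q`'s letters: bottom `J = diag(1,0)`, middle `[[0,−1],[−1,0]]`, top `diag(0,1)`. -/
def TQ : Fin 3 → Matrix (Fin 2) (Fin 2) ℝ := ![!![1, 0; 0, 0], !![0, -1; -1, 0], !![0, 0; 0, 1]]

/-- The exponents are strictly increasing. -/
theorem dP_strictMono : StrictMono dP := by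
  refine Fin.strictMono_iff_lt_succ.2 fun j => ?_
  fin_cases j <;> simp [dP]

/-- The exponents are strictly increasing. -/
theorem eQ_strictMono : StrictMono eQ := by
  refine Fin.strictMono_iff_lt_succ.2 fun j => ?_
  fin_cases j <;> simp [eQ]

/-- The letters are symmetric. -/
theorem SP_symm (l : Fin 3) : (SP l).IsSymm := by
  fin_cases l <;> (unfold Matrix.IsSymm; ext i j; fin_cases i <;> fin_cases j <;> rfl)

/-- The letters are symmetric. -/
theorem TQ_symm (l : Fin 3) : (TQ l).IsSymm := by
  fin_cases l <;> (unfold Matrix.IsSymm; ext i j; fin_cases i <;> fin_cases j <;> rfl)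

/-- Junction condition: the bottom letter of `Q` is the top letter of `P`. -/
theorem TQ_zero : TQ 0 = SP (Fin.last 2) := by
  ext i j; fin_cases i <;> fin_cases j <;> rfl

/-- The junction letter is nonzero. -/
theorem J_ne_zero : SP (Fin.last 2) ≠ 0 := by
  intro h
  have h00 := congrFun (congrFun h 0) 0
  simp [SP] at h00

/-- The junction letter is singular (corank one). -/
theorem J_det : (SP (Fin.last 2)).det = 0 := by
  simp [SP, Matrix.det_fin_two]

/-- closed form of `det P`. -/
theorem detP_eq : (pencil dP SP).det = C 1 * X ^ 4 + C (-1) * X ^ 6 := by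
  apply Polynomial.funext
  intro t
  unfold pencil
  rw [eval_det_pencil]
  simp [Matrix.det_fin_two, Fin.sum_univ_three, dP, SP]
  ring

/-- closed form of `det Q`. -/
theorem detQ_eq : (pencil eQ TQ).det = C (-1) * X ^ 2 + C 1 * X ^ 3 := by
  apply Polynomial.funext
  intro t
  unfold pencil
  rw [eval_det_pencil]
  simp [Matrix.det_fin_two, Fin.sum_univ_three, eQ, TQ]
  ring

/-- The block determinant is not the zero polynomial. -/
theorem detP_ne_zero : (pencil dP SP).det ≠ 0 := by
  rw [detP_eq]
  intro h
  have h4 := congrArg (fun p : ℝ[X] => p.coeff 4) h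
  simp [coeff_X_pow] at h4

/-- The block determinant is not the zero polynomial. -/
theorem detQ_ne_zero : (pencil eQ TQ).det ≠ 0 := by
  rw [detQ_eq]
  intro h
  have h3 := congrArg (fun p : ℝ[X] => p.coeff 3) h
  simp [coeff_X_pow] at h3

/-- Positive roots of the block determinant, counted with multiplicity. -/
theorem posM_P : posM (pencil dP SP).det ≤ 1 := posM_le_one_of_binomial 4 6 1 (-1) detP_eq detP_ne_zero
/-- Positive roots of the block determinant, counted with multiplicity. -/
theorem posM_Q : posM (pencil eQ TQ).det ≤ 1 := posM_le_one_of_binomial 2 3 (-1) 1 detQ_eq detQ_ne_zero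

/-- closed form of `det H_Λ` evaluated at a point. -/
theorem eval_detH (Λ x : ℝ) :
    ((junction 2 2 dP SP eQ TQ Λ).det).eval x =
      x ^ 4 - x ^ 6 + 2 * Λ⁻¹ * x ^ 8 - Λ⁻¹ ^ 2 * x ^ 10 + Λ⁻¹ ^ 3 * x ^ 11 := by
  unfold junction pencil
  rw [eval_det_pencil]
  simp [Matrix.det_fin_two, Fintype.sum_sum_type, Fin.sum_univ_three, Fin.sum_univ_two, dP, SP, eQ, TQ]
  ring

/-- with `Λ = t²`: the five values. -/
theorem val_half (t : ℝ) (ht : 4 ≤ t) : 0 < ((junction 2 2 dP SP eQ TQ (t ^ 2)).det).eval (1 / 2) := by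
  rw [eval_detH]
  have ht0 : 0 < t := by linarith
  have h1 : (0:ℝ) < (1/2) ^ 4 - (1/2) ^ 6 := by norm_num
  have h2 : (0:ℝ) ≤ 2 * (t ^ 2)⁻¹ * (1/2) ^ 8 - (t ^ 2)⁻¹ ^ 2 * (1/2) ^ 10 := by
    have hi : (t ^ 2)⁻¹ ≤ 1 := by
      rw [inv_le_one_iff₀]; right; nlinarith
    have hi0 : 0 ≤ (t ^ 2)⁻¹ := by positivity
    nlinarith
  have h3 : (0:ℝ) ≤ (t ^ 2)⁻¹ ^ 3 * (1/2) ^ 11 := by positivity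
  linarith

/-- Sign of `det H_Λ` at a certificate point (`Λ = t²`). -/
theorem val_two (t : ℝ) (ht : 4 ≤ t) : ((junction 2 2 dP SP eQ TQ (t ^ 2)).det).eval 2 < 0 := by
  rw [eval_detH]
  have ht0 : 0 < t := by linarith
  have hi : (t ^ 2)⁻¹ ≤ 1 / 16 := by
    rw [inv_le_comm₀ (by positivity) (by norm_num)]
    nlinarith
  have hi0 : 0 ≤ (t ^ 2)⁻¹ := by positivity
  nlinarith [mul_nonneg hi0 hi0, pow_le_pow_left₀ hi0 hi 2, pow_le_pow_left₀ hi0 hi 3]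

/-- Sign of `det H_Λ` at a certificate point (`Λ = t²`). -/
theorem val_t (t : ℝ) (ht : 4 ≤ t) : 0 < ((junction 2 2 dP SP eQ TQ (t ^ 2)).det).eval t := by
  rw [eval_detH]
  have ht0 : t ≠ 0 := by positivity
  have h : t ^ 4 - t ^ 6 + 2 * (t ^ 2)⁻¹ * t ^ 8 - (t ^ 2)⁻¹ ^ 2 * t ^ 10 + (t ^ 2)⁻¹ ^ 3 * t ^ 11 = t ^ 4 + t ^ 5 := by
    field_simp
    ring
  rw [h]
  positivity

/-- Sign of `det H_Λ` at a certificate point (`Λ = t²`). -/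
theorem val_2t (t : ℝ) (ht : 4 ≤ t) : ((junction 2 2 dP SP eQ TQ (t ^ 2)).det).eval (2 * t) < 0 := by
  rw [eval_detH]
  have ht0 : t ≠ 0 := by positivity
  have h : (2 * t) ^ 4 - (2 * t) ^ 6 + 2 * (t ^ 2)⁻¹ * (2 * t) ^ 8 - (t ^ 2)⁻¹ ^ 2 * (2 * t) ^ 10
      + (t ^ 2)⁻¹ ^ 3 * (2 * t) ^ 11 = t ^ 4 * (16 + 2048 * t - 576 * t ^ 2) := by
    field_simp
    ring
  rw [h]
  have h1 : 0 < t ^ 4 := by positivity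
  have h2 : 16 + 2048 * t - 576 * t ^ 2 < 0 := by nlinarith
  exact mul_neg_of_pos_of_neg h1 h2

/-- Sign of `det H_Λ` at a certificate point (`Λ = t²`). -/
theorem val_2Λ (t : ℝ) (ht : 4 ≤ t) : 0 < ((junction 2 2 dP SP eQ TQ (t ^ 2)).det).eval (2 * t ^ 2) := by
  rw [eval_detH]
  have ht0 : t ≠ 0 := by positivity
  have h : (2 * t ^ 2) ^ 4 - (2 * t ^ 2) ^ 6 + 2 * (t ^ 2)⁻¹ * (2 * t ^ 2) ^ 8 - (t ^ 2)⁻¹ ^ 2 * (2 * t ^ 2) ^ 10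
      + (t ^ 2)⁻¹ ^ 3 * (2 * t ^ 2) ^ 11 = t ^ 8 * (16 + t ^ 4 * (1024 * t ^ 4 - 64 + 512 * t ^ 2)) := by
    field_simp
    ring
  rw [h]
  have h1 : 1 ≤ t ^ 4 := one_le_pow₀ (by linarith)
  have h2 : 0 < 1024 * t ^ 4 - 64 + 512 * t ^ 2 := by nlinarith
  positivity

/-- FOUR distinct positive roots of `det H_{t²}` for every `t ≥ 4` (alternation `+,−,+,−,+` at `½ < 2 < t < 2t < 2t²`). -/
theorem four_le_posD (t : ℝ) (ht : 4 ≤ t) : 4 ≤ posD (junction 2 2 dP SP eQ TQ (t ^ 2)).det := by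
  unfold posD
  refine le_card_posRoots_of_alternating _ 4 (![1 / 2, 2, t, 2 * t, 2 * t ^ 2] : Fin 5 → ℝ) ?_ ?_ ?_
  · refine Fin.strictMono_iff_lt_succ.2 fun j => ?_
    fin_cases j <;> simp <;> nlinarith
  · intro j
    fin_cases j <;> simp <;> positivity
  · intro j
    fin_cases j <;> simp only
    · exact mul_neg_of_pos_of_neg (val_half t ht) (val_two t ht)
    · exact mul_neg_of_neg_of_pos (val_two t ht) (val_t t ht)
    · exact mul_neg_of_pos_of_neg (val_t t ht) (val_2t t ht)
    · exact mul_neg_of_neg_of_pos (val_2t t ht) (val_2Λ t ht)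

end SeamTwo

/-- **«+1 per junction» is false at `m = 2`.** -/
theorem not_seamPlusOne_two : ¬ SeamPlusOne 2 := by
  intro h
  have hev := h 2 2 SeamTwo.dP SeamTwo.SP SeamTwo.eQ SeamTwo.TQ SeamTwo.dP_strictMono SeamTwo.eQ_strictMono
    SeamTwo.SP_symm SeamTwo.TQ_symm SeamTwo.TQ_zero SeamTwo.J_ne_zero SeamTwo.J_det SeamTwo.detP_ne_zero SeamTwo.detQ_ne_zero
  obtain ⟨Λ₀, hΛ₀⟩ := Filter.eventually_atTop.1 hev
  set t : ℝ := max Λ₀ 4 with ht_def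
  have ht4 : 4 ≤ t := le_max_right _ _
  have htΛ : Λ₀ ≤ t ^ 2 := by
    have : Λ₀ ≤ t := le_max_left _ _
    nlinarith
  have hle := hΛ₀ (t ^ 2) htΛ
  have h4 := SeamTwo.four_le_posD t ht4
  have hP := SeamTwo.posM_P
  have hQ := SeamTwo.posM_Q
  omega


end Summit.ValiantsHypothesis.ValiantsHypothesis.Theorems.LacunarySymmetroidMatrixDescartes.JunctionCeiling
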